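import Literature.NumberTheory.Transcendental.Waldschmidt1980SizesB
import HarnessLib

/-!
# The `p`-adic Waldschmidt parameter record `PadicW80Par` (WP-A4, cell abc-stewartyu) — part A

/-!
# The `p`-adic Waldschmidt parameters (WP-A4, cell abc-stewartyu): the record `PadicW80Par`

Support file (plain definitions and theorems; no named facts). Twin of
`Waldschmidt1980Params/ParamsB.lean` (+ the `S₀`-dependent parts of `…Sizes/Numeric/Main`) for
the `p`-adic Cijsouw–Waldschmidt/Waldschmidt descent (`PadicCW77Main`). TWO changes w.r.t. `W80Par`:
* (F-p2-3, p2) in the `p`-adic set-up the eliminated generator `θ` carries a coefficient of MINIMAL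
  `p`-adic order and is NOT the one of largest height: the record has an arbitrary `1 ≤ V_θ ≤ V_max`
  next to `1 ≤ Vⱼ ≤ V_max`; `V_max` replaces `V_f`/`V_θ` inside the logarithms `W⋆ = max(W,
  m log(2¹³ m V_max))`, `G = m log(2¹⁷ m V_max)`, while `U = Aᵐ m^{2m+3}/m! · (∏Vⱼ) V_θ · W⋆ · G`
  keeps the true `V_θ`; the (unused) ordering lemma `L_θ ≤ Lⱼ` is dropped;
* (R-g, p1) `c_S = 2¹⁵` in place of `2¹³`: the `p`-adic extrapolation gains only `(log p)/2 ≥ 0.549`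
  per zero (radius `√p`; `PadicNewton.norm_tsum_le_max_of_small_jets_int'`, Yu 1989 Lemma 1.4)
  against W80's `log 21`, and all inequalities are homogeneous in `𝔘 = U/2ᵐ`, so only the zeros-per-𝔘
  ratio `kpts·t_J/(2ᵏ𝔘) ≈ c_S/(2c_T)` can pay: `KT_le`/`KT_ge` now give `(31/32)·2ᵏ𝔘 ≤ kpts·t_J ≤ 2ᵏ𝔘`.
Everything else (`c_T, c_L, c_L', Ap`, `T, h, L_b, Lⱼ, L_θ, J₀, t_J`, the Siegel count
`CW77.Setup.padic_siegel_count`, the endgame numbers) is W80's with the same proofs (HOME/p1/WP-A4-table.md).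

## References
* [Waldschmidt1980] M. Waldschmidt, *A lower bound for linear forms in logarithms*, Acta Arith. 37
  (1980), 257–283 — §3.2 (3.7)–(3.14) (pp. 264–265), Lemmas 3.2, 3.5 (pp. 266, 271), §3.5 (p. 274).
* [Yu1989] K. Yu, *Linear forms in p-adic logarithms*, Acta Arith. 53 (1989) — Lemma 1.4 (p. 117),
  (3.11) (p. 133).
-/
-/

noncomputable section

open Finset Real
open Literature.NumberTheory.Transcendental Literature.NumberTheory.Transcendental.Waldschmidt1980

namespace Summit.ABC.StewartYu

/-- **The parameters of the `p`-adic Waldschmidt descent.** `d ≥ 1` free logarithms of sizes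
`1 ≤ Vⱼ ≤ V_max`, the eliminated one of size `1 ≤ V_θ ≤ V_max` (NOT necessarily the largest:
p2's FLAG F-p2-3), and the coefficient bound `W ≥ 1`. [cite: Waldschmidt1980, §3.1–3.2 (pp. 263–264)] -/
structure PadicW80Par (d : ℕ) where
  /-- sizes of the free logarithms -/
  Vs : Fin d → ℝ
  /-- a common bound for ALL the sizes (inside the logarithms `W⋆`, `G`) -/
  Vmax : ℝ
  /-- the size of the eliminated logarithm -/
  Vel : ℝ
  /-- the coefficient bound (`W ≥ log max |bⱼ|`) -/
  Wb : ℝ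
  /-- `Vⱼ ≥ 1` -/
  hV : ∀ j, 1 ≤ Vs j
  /-- `Vⱼ ≤ V_max` -/
  hVmax : ∀ j, Vs j ≤ Vmax
  /-- `1 ≤ V_max` -/
  hVmax1 : 1 ≤ Vmax
  /-- `1 ≤ V_θ` -/
  hVθ1 : 1 ≤ Vel
  /-- `V_θ ≤ V_max` -/
  hVθmax : Vel ≤ Vmax
  /-- `W ≥ 1` -/
  hW : 1 ≤ Wb
  /-- at least one free logarithm -/
  hd : 1 ≤ d


namespace PadicW80Par

variable {d : ℕ} (P : PadicW80Par d)

/-! ### The constants -/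

/-- `c_T = 2¹⁴`. [folklore] -/
def cTp : ℝ := 2 ^ 14
/-- `c_S = 2¹³` (`c_S/c_T = 1/2`). [folklore] -/
def cSp : ℝ := 2 ^ 15
/-- `c_L = 2¹⁴`. [folklore] -/
def cLp : ℝ := 2 ^ 14
/-- `c_L' = 2¹²`. [folklore] -/
def cLp' : ℝ := 2 ^ 12
/-- `Ap = 2⁵⁰` (the base of the constant `Aᵐ`). [folklore] -/
def Ap : ℝ := 2 ^ 50

/-! ### The derived parameters -/

/-- The number of logarithms `m = d + 1`, as a real number. [folklore] -/
def mRp (d : ℕ) : ℝ := (d : ℝ) + 1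

/-- `W⋆ = max(W, m log(2¹³ m V_θ))` (Waldschmidt's `W*`, (3.2)). [cite: Waldschmidt1980, §3.2 (p. 264)] -/
def Wstarp : ℝ := max P.Wb (mRp d * Real.log (2 ^ 13 * mRp d * P.Vmax))

/-- `G = m log(2¹⁷ m V_f)` (Waldschmidt's `log V*_{n−1}`, (3.2)). [cite: Waldschmidt1980, §3.2 (p. 264)] -/
def Gp : ℝ := mRp d * Real.log (2 ^ 17 * mRp d * P.Vmax)

/-- **`U = Aᵐ · m^{2m+1}/m! · (∏ Vⱼ) V_θ · W⋆ · G`** (Waldschmidt's `U₂`, p. 264).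
[cite: Waldschmidt1980, §3.1 (p. 264)] -/
def Up : ℝ := Ap ^ (d + 1) * (mRp d ^ (2 * d + 3) / (d + 1).factorial) * ((∏ j, P.Vs j) * P.Vel) *
  P.Wstarp * P.Gp

/-- `S₀ = 2 ⌊c_S m W⋆⌋` (even; the points of level `0` are the odd `s < S₀`). [cite: Waldschmidt1980, (3.2) p. 264] -/
def S₀p : ℕ := 2 * ⌊cSp * mRp d * P.Wstarp⌋₊

/-- `T = ⌊U/(c_T 2ᵐ W⋆)⌋`. [cite: Waldschmidt1980, (3.2) p. 264] -/
def Tp : ℕ := ⌊P.Up / (cTp * 2 ^ (d + 1) * P.Wstarp)⌋₊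

/-- `h = ⌊W⋆/G⌋ + 1` (the block length of the `Δ`-polynomials, Waldschmidt's `L₋₁ + 1`).
[cite: Waldschmidt1980, (3.2) p. 264] -/
def hparp : ℕ := ⌊P.Wstarp / P.Gp⌋₊ + 1

/-- `L_b = ⌊U/(c_L 2ᵐ G h)⌋ + 1` (the number of blocks, Waldschmidt's `L₀ + 1`). [cite: Waldschmidt1980, (3.2) p. 264] -/
def Lbp : ℕ := ⌊P.Up / (cLp * 2 ^ (d + 1) * P.Gp * P.hparp)⌋₊ + 1

/-- `Lⱼ = ⌊U/(c_L' m 2^{m+1} S₀ Vⱼ)⌋`. [cite: Waldschmidt1980, (3.2) p. 264] -/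
def Lp (j : Fin d) : ℕ := ⌊P.Up / (cLp' * mRp d * 2 ^ (d + 2) * P.S₀p * P.Vs j)⌋₊

/-- `L_θ = ⌊U/(c_L' m 2^{m+1} S₀ V_θ)⌋` (the smallest range). [cite: Waldschmidt1980, (3.2) p. 264] -/
def Lθp : ℕ := ⌊P.Up / (cLp' * mRp d * 2 ^ (d + 2) * P.S₀p * P.Vel)⌋₊

/-- `J₀ = [log₂ L_θ] + 1` descent steps. [cite: Waldschmidt1980, §3.5 (p. 274)] -/
def J₀p : ℕ := Nat.log 2 P.Lθp + 1

/-! ### Elementary inequalities -/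

/-- `1 ≤ m`, `2 ≤ m`. [folklore] -/
theorem two_le_mR (P : PadicW80Par d) : (2 : ℝ) ≤ mRp d := by
  have h1 : (1 : ℝ) ≤ d := by exact_mod_cast P.hd
  unfold mRp
  linarith

/-- `0 < m`. [folklore] -/
theorem mR_pos (P : PadicW80Par d) : (0 : ℝ) < mRp d := by linarith [(two_le_mR P)]

/-- `1 ≤ V_θ`. [folklore] -/
theorem one_le_Vθ : (1 : ℝ) ≤ P.Vel := P.hVθ1

/-- `1 ≤ V_max`. [folklore] -/
theorem one_le_Vmax : (1 : ℝ) ≤ P.Vmax := P.hVmax1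

/-- `W⋆ ≥ W ≥ 1`. [folklore] -/
theorem W_le_Wstar : P.Wb ≤ P.Wstarp := le_max_left _ _

/-- `1 ≤ W⋆`. [folklore] -/
theorem one_le_Wstar : (1 : ℝ) ≤ P.Wstarp := P.hW.trans P.W_le_Wstar

/-- `W⋆ ≥ m log(2¹³ m V_θ)`. [folklore] -/
theorem mlog_le_Wstar : mRp d * Real.log (2 ^ 13 * mRp d * P.Vmax) ≤ P.Wstarp := le_max_right _ _

/-- `log(2¹³ m V_θ) ≥ 9` (`2¹³ · 2 = 2¹⁴ ≥ e⁹`). [folklore] -/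
theorem nine_le_log : (9 : ℝ) ≤ Real.log (2 ^ 13 * mRp d * P.Vmax) := by
  have h1 : (2 : ℝ) ^ 14 ≤ 2 ^ 13 * mRp d * P.Vmax := by
    have := (two_le_mR P); have := P.hVmax1
    calc (2 : ℝ) ^ 14 = 2 ^ 13 * 2 * 1 := by norm_num
      _ ≤ 2 ^ 13 * mRp d * P.Vmax := by gcongr
  have h2 : Real.exp 9 ≤ (2 : ℝ) ^ 14 := by
    have := Real.exp_one_lt_d9
    calc Real.exp 9 = Real.exp 1 ^ 9 := by rw [← Real.exp_nat_mul]; norm_num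
      _ ≤ (2.7182818286 : ℝ) ^ 9 := by gcongr
      _ ≤ 2 ^ 14 := by norm_num
  calc (9 : ℝ) = Real.log (Real.exp 9) := (Real.log_exp 9).symm
    _ ≤ Real.log (2 ^ 13 * mRp d * P.Vmax) := Real.log_le_log (Real.exp_pos _) (h2.trans h1)

/-- `W⋆ ≥ 9m ≥ 18`. [folklore] -/
theorem nine_mR_le_Wstar : 9 * mRp d ≤ P.Wstarp := by
  have h := P.mlog_le_Wstar
  have h9 := P.nine_le_log
  have hm := (mR_pos P)
  nlinarith

/-- `log(2¹⁷ m V_f) ≥ 11` (`2¹⁸ ≥ e¹¹`). [folklore] -/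
theorem eleven_le_logG : (11 : ℝ) ≤ Real.log (2 ^ 17 * mRp d * P.Vmax) := by
  have h1 : (2 : ℝ) ^ 18 ≤ 2 ^ 17 * mRp d * P.Vmax := by
    have := (two_le_mR P); have := P.hVmax1
    calc (2 : ℝ) ^ 18 = 2 ^ 17 * 2 * 1 := by norm_num
      _ ≤ 2 ^ 17 * mRp d * P.Vmax := by gcongr
  have h2 : Real.exp 11 ≤ (2 : ℝ) ^ 18 := by
    have := Real.exp_one_lt_d9
    calc Real.exp 11 = Real.exp 1 ^ 11 := by rw [← Real.exp_nat_mul]; norm_num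
      _ ≤ (2.7182818286 : ℝ) ^ 11 := by gcongr
      _ ≤ 2 ^ 18 := by norm_num
  calc (11 : ℝ) = Real.log (Real.exp 11) := (Real.log_exp 11).symm
    _ ≤ Real.log (2 ^ 17 * mRp d * P.Vmax) := Real.log_le_log (Real.exp_pos _) (h2.trans h1)

/-- `G ≥ 11 m ≥ 22`. [folklore] -/
theorem eleven_mR_le_G : 11 * mRp d ≤ P.Gp := by
  unfold Gp; have := P.eleven_le_logG; have := (mR_pos P); nlinarith

/-- `0 < G`. [folklore] -/
theorem G_pos : 0 < P.Gp := by have := P.eleven_mR_le_G; have := (mR_pos P); nlinarith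

/-- **`G ≤ 2 W⋆`**: `2¹⁷ m V_f ≤ (2¹³ m V_θ)²`. [folklore] -/
theorem G_le_two_Wstar : P.Gp ≤ 2 * P.Wstarp := by
  have hm := (two_le_mR P)
  have hVθ := P.hVmax1
  have h1 : (2 : ℝ) ^ 17 * mRp d * P.Vmax ≤ (2 ^ 13 * mRp d * P.Vmax) ^ 2 := by
    have hVf0 : P.Vmax ≤ P.Vmax := le_rfl
    have hm1 : 1 ≤ mRp d := by linarith
    have hVf1 := P.hVmax1
    have e : (2 ^ 13 * mRp d * P.Vmax) ^ 2 = (2 : ℝ) ^ 26 * ((mRp d * mRp d) * (P.Vmax * P.Vmax)) := by ring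
    rw [e]
    have h2 : mRp d * P.Vmax ≤ (mRp d * mRp d) * (P.Vmax * P.Vmax) := by
      calc mRp d * P.Vmax ≤ mRp d * P.Vmax := mul_le_mul_of_nonneg_left hVf0 (by linarith)
        _ = (mRp d * 1) * (P.Vmax * 1) := by ring
        _ ≤ (mRp d * mRp d) * (P.Vmax * P.Vmax) := by gcongr
    calc (2 : ℝ) ^ 17 * mRp d * P.Vmax = 2 ^ 17 * (mRp d * P.Vmax) := by ring
      _ ≤ 2 ^ 26 * (mRp d * P.Vmax) := by gcongr <;> norm_num
      _ ≤ 2 ^ 26 * ((mRp d * mRp d) * (P.Vmax * P.Vmax)) := by gcongr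
  have hpos : (0 : ℝ) < 2 ^ 17 * mRp d * P.Vmax := by have := P.hVmax1; positivity
  calc P.Gp = mRp d * Real.log (2 ^ 17 * mRp d * P.Vmax) := rfl
    _ ≤ mRp d * Real.log ((2 ^ 13 * mRp d * P.Vmax) ^ 2) :=
        mul_le_mul_of_nonneg_left (Real.log_le_log hpos h1) (mR_pos P).le
    _ = 2 * (mRp d * Real.log (2 ^ 13 * mRp d * P.Vmax)) := by rw [Real.log_pow]; push_cast; ring
    _ ≤ 2 * P.Wstarp := by linarith [P.mlog_le_Wstar]

/-- `0 < U`. [folklore] -/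
theorem U_pos : 0 < P.Up := by
  unfold Up Ap
  have := P.one_le_Wstar; have := P.G_pos; have := P.one_le_Vθ; have := (mR_pos P)
  have hV : 0 < ∏ j, P.Vs j := prod_pos fun j _ => lt_of_lt_of_le one_pos (P.hV j)
  positivity

/-- **The size of the unit `U/2ᵐ`**: `U/(2ᵐ W⋆) ≥ 2^{49m} · G · (∏ Vⱼ) V_θ ≥ 2^{49m}`
(`m^{2m+1}/m! ≥ 1`). [folklore] -/
theorem U_div_ge : (2 : ℝ) ^ (49 * (d + 1)) * P.Gp * ((∏ j, P.Vs j) * P.Vel) * P.Wstarp ≤ P.Up / 2 ^ (d + 1) := by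
  unfold Up Ap
  rw [le_div_iff₀ (by positivity)]
  have hfac : (1 : ℝ) ≤ mRp d ^ (2 * d + 3) / (d + 1).factorial := by
    rw [le_div_iff₀ (by positivity), one_mul]
    have h1 : ((d + 1).factorial : ℝ) ≤ ((d + 1 : ℕ) : ℝ) ^ (d + 1) := by
      exact_mod_cast Nat.factorial_le_pow (d + 1)
    have h2 : ((d + 1 : ℕ) : ℝ) ^ (d + 1) ≤ mRp d ^ (2 * d + 3) := by
      have hm : ((d + 1 : ℕ) : ℝ) = mRp d := by unfold mRp; push_cast; ring
      rw [hm]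
      exact pow_le_pow_right₀ (by linarith [(two_le_mR P)]) (by omega)
    exact h1.trans h2
  have hW := P.one_le_Wstar; have hG := P.G_pos; have hVθ := P.one_le_Vθ
  have hV : 1 ≤ ∏ j, P.Vs j := by
    have : ∏ _j : Fin d, (1 : ℝ) ≤ ∏ j, P.Vs j :=
      prod_le_prod (fun _ _ => zero_le_one) fun j _ => P.hV j
    simpa using this
  have hVV : 0 ≤ (∏ j, P.Vs j) * P.Vel := by positivity
  have hpow : (2 : ℝ) ^ (49 * (d + 1)) * 2 ^ (d + 1) = (2 ^ 50) ^ (d + 1) := by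
    rw [← pow_mul, ← pow_add]; congr 1; ring
  calc (2 : ℝ) ^ (49 * (d + 1)) * P.Gp * ((∏ j, P.Vs j) * P.Vel) * P.Wstarp * 2 ^ (d + 1)
      = (2 ^ 50) ^ (d + 1) * 1 * ((∏ j, P.Vs j) * P.Vel) * P.Wstarp * P.Gp := by rw [← hpow]; ring
    _ ≤ (2 ^ 50) ^ (d + 1) * (mRp d ^ (2 * d + 3) / (d + 1).factorial) * ((∏ j, P.Vs j) * P.Vel) *
          P.Wstarp * P.Gp := by gcongr

/-- `U/(2ᵐ W⋆) ≥ 2^{49m}` (a convenient weak form). [folklore] -/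
theorem U_div_ge' : (2 : ℝ) ^ (49 * (d + 1)) ≤ P.Up / (2 ^ (d + 1) * P.Wstarp) := by
  have h := P.U_div_ge
  have hW := P.one_le_Wstar
  have hG : 1 ≤ P.Gp := by have := P.eleven_mR_le_G; have := (two_le_mR P); nlinarith
  have hV : 1 ≤ (∏ j, P.Vs j) * P.Vel := by
    have h1 : 1 ≤ ∏ j, P.Vs j := by
      have : ∏ _j : Fin d, (1 : ℝ) ≤ ∏ j, P.Vs j :=
        prod_le_prod (fun _ _ => zero_le_one) fun j _ => P.hV j
      simpa using this
    nlinarith [P.one_le_Vθ]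
  rw [le_div_iff₀ (by positivity)]
  rw [le_div_iff₀ (by positivity)] at h
  have h49 : (0 : ℝ) ≤ 2 ^ (49 * (d + 1)) := by positivity
  calc (2 : ℝ) ^ (49 * (d + 1)) * (2 ^ (d + 1) * P.Wstarp)
      = 2 ^ (49 * (d + 1)) * 1 * 1 * P.Wstarp * 2 ^ (d + 1) := by ring
    _ ≤ 2 ^ (49 * (d + 1)) * P.Gp * ((∏ j, P.Vs j) * P.Vel) * P.Wstarp * 2 ^ (d + 1) := by gcongr
    _ ≤ P.Up := h

/-! ### `S₀`, `T` -/

/-- `S₀` is even. [folklore] -/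
theorem even_S₀ : Even P.S₀p := ⟨⌊cSp * mRp d * P.Wstarp⌋₊, by unfold S₀p; ring⟩

/-- `c_S m W⋆ ≥ 2¹⁴`. [folklore] -/
theorem cS_mul_ge : (2 : ℝ) ^ 14 ≤ cSp * mRp d * P.Wstarp := by
  unfold cSp
  have := (two_le_mR P); have := P.one_le_Wstar
  calc (2 : ℝ) ^ 14 ≤ 2 ^ 15 * 2 * 1 := by norm_num
    _ ≤ 2 ^ 15 * mRp d * P.Wstarp := by gcongr

/-- `S₀ ≤ 2 c_S m W⋆`. [folklore] -/
theorem S₀_le : (P.S₀p : ℝ) ≤ 2 * (cSp * mRp d * P.Wstarp) := by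
  unfold S₀p
  push_cast
  have := Nat.floor_le (show 0 ≤ cSp * mRp d * P.Wstarp by have := P.cS_mul_ge; linarith)
  linarith

/-- `c_S m W⋆ ≤ S₀` (indeed `S₀ ≥ 2 c_S m W⋆ − 2`). [folklore] -/
theorem S₀_ge : cSp * mRp d * P.Wstarp ≤ P.S₀p := by
  unfold S₀p
  push_cast
  have h1 := Nat.lt_floor_add_one (cSp * mRp d * P.Wstarp)
  have h2 := P.cS_mul_ge
  linarith

/-- `2 ≤ S₀`. [folklore] -/
theorem two_le_S₀ : 2 ≤ P.S₀p := by
  have h := P.S₀_ge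
  have h2 := P.cS_mul_ge
  have : (2 : ℝ) ≤ P.S₀p := by linarith
  exact_mod_cast this

/-- `0 < S₀` (real). [folklore] -/
theorem S₀_pos : (0 : ℝ) < P.S₀p := by have := P.two_le_S₀; exact_mod_cast (by omega : 0 < P.S₀p)

/-- `T ≤ U/(c_T 2ᵐ W⋆)`. [folklore] -/
theorem T_le : (P.Tp : ℝ) ≤ P.Up / (cTp * 2 ^ (d + 1) * P.Wstarp) := by
  unfold Tp
  exact Nat.floor_le (by unfold cTp; have := P.U_pos; have := P.one_le_Wstar; positivity)

/-- `U/(c_T 2ᵐ W⋆) ≥ 2`. [folklore] -/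
theorem two_le_U_div_cT : (2 : ℝ) ≤ P.Up / (cTp * 2 ^ (d + 1) * P.Wstarp) := by
  have h := P.U_div_ge'
  have hW := P.one_le_Wstar
  unfold cTp
  rw [le_div_iff₀ (by positivity)]
  rw [le_div_iff₀ (by positivity)] at h
  have h50 : (2 : ℝ) * 2 ^ 14 ≤ 2 ^ (49 * (d + 1)) := by
    calc (2 : ℝ) * 2 ^ 14 = 2 ^ 15 := by norm_num
      _ ≤ 2 ^ (49 * (d + 1)) := pow_le_pow_right₀ (by norm_num) (by omega)
  calc (2 : ℝ) * (2 ^ 14 * 2 ^ (d + 1) * P.Wstarp) = (2 * 2 ^ 14) * (2 ^ (d + 1) * P.Wstarp) := by ring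
    _ ≤ 2 ^ (49 * (d + 1)) * (2 ^ (d + 1) * P.Wstarp) := by gcongr
    _ ≤ P.Up := h

/-- `U/(2 c_T 2ᵐ W⋆) ≤ T` (the floor costs at most a factor `2`). [folklore] -/
theorem T_ge : P.Up / (cTp * 2 ^ (d + 1) * P.Wstarp) / 2 ≤ P.Tp := by
  unfold Tp
  have h1 := Nat.lt_floor_add_one (P.Up / (cTp * 2 ^ (d + 1) * P.Wstarp))
  have h2 := P.two_le_U_div_cT
  linarith

/-- `1 ≤ T`. [folklore] -/
theorem one_le_T : 1 ≤ P.Tp := by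
  have h := P.T_ge
  have h2 := P.two_le_U_div_cT
  have : (1 : ℝ) ≤ P.Tp := by linarith
  exact_mod_cast this

/-! ### `L_θ`, `Lⱼ`, `J₀` -/

/-- The denominator of `L_θ` is positive. [folklore] -/
theorem den_Lθ_pos : 0 < cLp' * mRp d * 2 ^ (d + 2) * P.S₀p * P.Vel := by
  unfold cLp'; have := (mR_pos P); have := P.S₀_pos; have := P.one_le_Vθ; positivity

/-- `L_θ ≤ U/(c_L' m 2^{m+1} S₀ V_θ)`. [folklore] -/
theorem Lθ_le : (P.Lθp : ℝ) ≤ P.Up / (cLp' * mRp d * 2 ^ (d + 2) * P.S₀p * P.Vel) := by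
  unfold Lθp
  exact Nat.floor_le (div_nonneg P.U_pos.le P.den_Lθ_pos.le)

end PadicW80Par

end Summit.ABC.StewartYu

end
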